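import Summits.CriticalPhenomena.PercolationContinuityZ3.Theorems.Transplant.FKThreeApexT3Form
import Summits.CriticalPhenomena.PercolationContinuityZ3.Theorems.Transplant.FKThreeApexT5Final
import Summits.CriticalPhenomena.PercolationContinuityZ3.Theorems.Transplant.FKThreeApexPhiNat
import Summits.CriticalPhenomena.PercolationContinuityZ3.Theorems.Transplant.FKThreeApexNegCorr
import HarnessLib

/-!
# The three-apex monoid: the DOUBLE-ENVELOPE REDUCTION of type T3

Helper file (`--supports stmt-CriticalPhenomena-4575`), FK sub-lane `prim-bschramm-fk-3` (gen 16); builds on p205010 (kernel theorem, internal audit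
signed; external expert review pending).  No sorries; standard axioms.  Memo `bschramm/prim-bschramm-fk-3/T3-ENVELOPE.md`.

Type T3 (the leaf edge `u₁a` against the leaf edge `u₂b` of the weighted `K_{1,1,1,n}`, `0 < q ≤ 1`) is the last open pair type; its Rayleigh
form `t3Form q b₁ c₁ a₂ c₂ R` (file `…T3Form`) is a quadratic form in the hat coordinates of the rest `R` with coefficients depending on FOUR
leaf probabilities.  This file removes the leaf parameters:

* **Peeling** (`conv_kappa_leaf`): the contracted leaf is the deleted leaf times an explicit signed five-vector `κ`, `(λ λ')·L(1,b,c) = κ(b,c) * L(0,b,c)`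
  (`λ = q b̄c̄ + b c̄ + b̄ c`, `λ' = λ + bc`).  Hence (`t3_master_identity`)
  `λλ'μμ' · t3Form(R) = q²(1−q) · envForm q A₁ A₂ m A₁' A₂' m' R₂`, `R₂ = L(0,b₁,c₁) * L(a₂,0,c₂) * R ∈ InK`, where `envForm` is an explicit
  BILINEAR form in the two coefficient vectors `k = (A₁, A₂, −m, qm)`, `k' = (A₁', −m', A₂', qm')` over the merges `(ab, ac, bc, abc)` with the ten
  'environment forms' `E_aa, E_bb, E_cc, N^{ab}, N^{ac}, N^{bc}, P_ab, P_ac, P_bc, P₁` of `R₂` (all non-negative on the monoid) as coefficients, and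
  `(A₁, A₂, m) = (b₁c̄₁λ', c₁b̄₁λ', b₁c₁b̄₁c̄₁)` satisfies the ADMISSIBILITY `(A₁ − m)(A₂ − m) ≥ m²`, `A₁, A₂ ≥ m ≥ 0`.
* **Monotone reduction** (`envForm_mono₁/₂`): `envForm` is non-decreasing in `A₁, A₂` (resp. `A₁', A₂'`) for admissible partners — by Theorem M and
  the U-inequalities `InK.uCond` / `InK.phiB_nonneg` — so it suffices to know `envForm ≥ 0` on the FRONTIER `(A₁,A₂,m) ∝ (θ(1+θ), 1+θ, θ)`,
  i.e. the two-parameter statement `EnvelopeA q : ∀ θ θ' ≥ 0, ∀ Z ∈ InK q, 0 ≤ vForm q θ θ' Z`.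
* **Theorem** `InK.t3Form_nonneg_of_envelopeA`: `EnvelopeA q → T3` (all four leaf probabilities in `[0,1]`, all `R ∈ InK q`, `0 < q ≤ 1`).

`EnvelopeA q` is proved for `q ∈ [1/2, 1]` in the companion certificate file. [folklore]
-/

noncomputable section

namespace Summit.CriticalPhenomena.PercolationContinuityZ3.Theorems

namespace FK

namespace ThreeApex

/-! ### The ten environment forms (hat coordinates `u = Z₀, x, y, z, v = |Z|`) -/

/-- `N^{ab} = x v + (1−q) y z − (2−q) u v` (`= masterN q (swapBC Z)`, Theorem M). [folklore] -/
def nAB (q : ℝ) (Z : V5) : ℝ := hx Z * Z.total + (1 - q) * hy Z * hz Z - (2 - q) * Z.z0 * Z.total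
/-- `N^{ac} = y v + (1−q) x z − (2−q) u v` (`= masterN q Z`). [folklore] -/
def nAC (q : ℝ) (Z : V5) : ℝ := hy Z * Z.total + (1 - q) * hx Z * hz Z - (2 - q) * Z.z0 * Z.total
/-- `N^{bc} = z v + (1−q) x y − (2−q) u v` (`= masterN q (swapAB Z)`). [folklore] -/
def nBC (q : ℝ) (Z : V5) : ℝ := hz Z * Z.total + (1 - q) * hx Z * hy Z - (2 - q) * Z.z0 * Z.total
/-- `E_aa = (v − (1−q)x)(y + z − (2−q)u)` (self-pairing of the `ab`-merge). [folklore] -/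
def eAA (q : ℝ) (Z : V5) : ℝ := (Z.total - (1 - q) * hx Z) * (hy Z + hz Z - (2 - q) * Z.z0)
/-- `E_bb = (v − (1−q)y)(x + z − (2−q)u)`. [folklore] -/
def eBB (q : ℝ) (Z : V5) : ℝ := (Z.total - (1 - q) * hy Z) * (hx Z + hz Z - (2 - q) * Z.z0)
/-- `E_cc = (v − (1−q)z)(x + y − (2−q)u)`. [folklore] -/
def eCC (q : ℝ) (Z : V5) : ℝ := (Z.total - (1 - q) * hz Z) * (hx Z + hy Z - (2 - q) * Z.z0)
/-- `P_ab = v (y + z − (2−q)u)` (pairing of the `ab`-merge with the full merge). [folklore] -/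
def pAB (q : ℝ) (Z : V5) : ℝ := Z.total * (hy Z + hz Z - (2 - q) * Z.z0)
/-- `P_ac = v (x + z − (2−q)u)`. [folklore] -/
def pAC (q : ℝ) (Z : V5) : ℝ := Z.total * (hx Z + hz Z - (2 - q) * Z.z0)
/-- `P_bc = v (x + y − (2−q)u)`. [folklore] -/
def pBC (q : ℝ) (Z : V5) : ℝ := Z.total * (hx Z + hy Z - (2 - q) * Z.z0)
/-- `P₁ = v (x + y + z − (2−q)u)` (self-pairing of the full merge). [folklore] -/
def pTop (q : ℝ) (Z : V5) : ℝ := Z.total * (hx Z + hy Z + hz Z - (2 - q) * Z.z0)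
/-- The mass at apex `c`: `M_c = (y + z − (2−q)u)(v − x)`. [folklore] -/
def massC (q : ℝ) (Z : V5) : ℝ := (hy Z + hz Z - (2 - q) * Z.z0) * (Z.total - hx Z)

/-- `N^{ab}` is the master form of the `b ↔ c` relabelling. [folklore] -/
theorem nAB_eq (q : ℝ) (Z : V5) : nAB q Z = masterN q (swapBC Z) := by
  simp only [nAB, masterN, swapBC, hx, hy, hz, V5.total]; ring
/-- `N^{ac}` is the master form. [folklore] -/
theorem nAC_eq (q : ℝ) (Z : V5) : nAC q Z = masterN q Z := by
  simp only [nAC, masterN, hx, hy, hz, V5.total]; ring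
/-- `N^{bc}` is the master form of the `a ↔ b` relabelling. [folklore] -/
theorem nBC_eq (q : ℝ) (Z : V5) : nBC q Z = masterN q (swapAB Z) := by
  simp only [nBC, masterN, swapAB, hx, hy, hz, V5.total]; ring

/-- **The bilinear envelope form** `Σ_{g,g'} k_g k'_{g'} Ŵ(g,g')` for `k = (A₁, A₂, −m, qm)` (an `a`-pinned object: merges `ab, ac`, opposite `bc`,
full merge) and `k' = (A₁', −m', A₂', qm')` (a `b`-pinned object: merges `ab`, opposite `ac`, `bc`, full merge), with the merge–merge Rayleigh matrix
`Ŵ = [[E_aa, N^{bc}, N^{ac}, P_ab], [N^{bc}, E_bb, N^{ab}, P_ac], [N^{ac}, N^{ab}, E_cc, P_bc], [P_ab, P_ac, P_bc, P₁]]`. [folklore] -/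
def envForm (q A₁ A₂ m A₁' A₂' m' : ℝ) (Z : V5) : ℝ :=
  A₁ * A₁' * eAA q Z - A₁ * m' * nBC q Z + A₁ * A₂' * nAC q Z + A₁ * (q * m') * pAB q Z
  + A₂ * A₁' * nBC q Z - A₂ * m' * eBB q Z + A₂ * A₂' * nAB q Z + A₂ * (q * m') * pAC q Z
  - m * A₁' * nAC q Z + m * m' * nAB q Z - m * A₂' * eCC q Z - m * (q * m') * pBC q Z
  + q * m * A₁' * pAB q Z - q * m * m' * pAC q Z + q * m * A₂' * pBC q Z + q * m * (q * m') * pTop q Z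

/-- **The frontier form** `V(θ,θ') = envForm` at the frontier vectors `(A₁,A₂,m) = (θ(1+θ), 1+θ, θ)`, `(A₁',A₂',m') = (θ'(1+θ'), 1+θ', θ')`
(the `q = 0` limits of infinitesimal leaves; the 'U2 pseudo-objects' of memo T3-STRUCTURE §0(E)). [folklore] -/
def vForm (q θ θ' : ℝ) (Z : V5) : ℝ := envForm q (θ * (1 + θ)) (1 + θ) θ (θ' * (1 + θ')) (1 + θ') θ' Z

/-- **Envelope statement (A)**: the frontier form is non-negative on the monoid for all `θ, θ' ≥ 0`.  By `InK.t3Form_nonneg_of_envelopeA` this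
two-parameter statement implies type T3 for all four leaf probabilities. [folklore] -/
def EnvelopeA (q : ℝ) : Prop := ∀ θ θ' : ℝ, 0 ≤ θ → 0 ≤ θ' → ∀ Z : V5, InK q Z → 0 ≤ vForm q θ θ' Z

/-! ### Scaling and the valuation of a letter action -/

/-- Scalar multiple of a five-vector. [folklore] -/
def scaleV (c : ℝ) (Z : V5) : V5 := ⟨c * Z.z0, c * Z.zab, c * Z.zac, c * Z.zbc, c * Z.z1⟩

/-- `val` is linear: `val (c Z) = c val Z`. [folklore] -/
theorem val_scaleV (q c : ℝ) (Z : V5) : val q (scaleV c Z) = c * val q Z := by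
  simp only [val, scaleV]; ring

/-- `conv` is linear in the letter: `(c z) * W = c (z * W)`. [folklore] -/
theorem conv_scaleV_left (c : ℝ) (z W : V5) : conv (scaleV c z) W = scaleV c (conv z W) := by
  ext <;> simp only [conv, scaleV, V5.total] <;> ring

/-- `conv` is linear in the product: `z * (c W) = c (z * W)`. [folklore] -/
theorem conv_scaleV_right (c : ℝ) (z W : V5) : conv z (scaleV c W) = scaleV c (conv z W) := by
  ext <;> simp only [conv, scaleV, V5.total] <;> ring

/-- **Bilinear expansion.** For arbitrary five-vectors `κ, κ'` and `W`:
`val(κW)·val(κ'W) − val(κκ'W)·val(W) = q²(1−q)·Σ_{g,g'} κ_g κ'_{g'} Ŵ(g,g')(W)` — the sixteen merge–merge Rayleigh differences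
`Z^g Z^{g'} − Z^{g∨g'} Z` of `W` (the `δ₀`-components drop out). [folklore] -/
theorem val_conv_bilin (q : ℝ) (κ κ' W : V5) :
    val q (conv κ W) * val q (conv κ' W) - val q (conv κ (conv κ' W)) * val q W =
      q ^ 2 * (1 - q) *
        (κ.zab * κ'.zab * eAA q W + κ.zab * κ'.zac * nBC q W + κ.zab * κ'.zbc * nAC q W + κ.zab * κ'.z1 * pAB q W
        + κ.zac * κ'.zab * nBC q W + κ.zac * κ'.zac * eBB q W + κ.zac * κ'.zbc * nAB q W + κ.zac * κ'.z1 * pAC q W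
        + κ.zbc * κ'.zab * nAC q W + κ.zbc * κ'.zac * nAB q W + κ.zbc * κ'.zbc * eCC q W + κ.zbc * κ'.z1 * pBC q W
        + κ.z1 * κ'.zab * pAB q W + κ.z1 * κ'.zac * pAC q W + κ.z1 * κ'.zbc * pBC q W + κ.z1 * κ'.z1 * pTop q W) := by
  simp only [val, conv, eAA, eBB, eCC, nAB, nAC, nBC, pAB, pAC, pBC, pTop, hx, hy, hz, V5.total]
  ring

/-- Associativity of the letter action (the monoid law, in `conv` notation). [folklore] -/
theorem conv_assoc' (a b c : V5) : conv (conv a b) c = conv a (conv b c) := mul_assoc a b c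

/-! ### Peeling a pinned leaf -/

/-- `λ(b,c) = q b̄ c̄ + b c̄ + b̄ c`: the `Z₀`-mass of the deleted leaf `L(0,b,c)`. [folklore] -/
def lamOf (q b c : ℝ) : ℝ := q * (1 - b) * (1 - c) + b * (1 - c) + (1 - b) * c
/-- `λ'(b,c) = λ + bc`: the total mass of `L(0,b,c)`. [folklore] -/
def lamPOf (q b c : ℝ) : ℝ := lamOf q b c + b * c

/-- The peeling vector of an `a`-pinned leaf with remaining probabilities `b, c`:
`κ = (b̄c̄λ', b c̄ λ', c b̄ λ', −b c b̄ c̄, q b c b̄ c̄)` over `(δ₀, ab, ac, bc, abc)`. [folklore] -/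
def kappaA (q b c : ℝ) : V5 :=
  ⟨(1 - b) * (1 - c) * lamPOf q b c, b * (1 - c) * lamPOf q b c, c * (1 - b) * lamPOf q b c,
    -(b * c * (1 - b) * (1 - c)), q * (b * c * (1 - b) * (1 - c))⟩

/-- The peeling vector of a `b`-pinned leaf with remaining probabilities `a, c`:
`κ' = (āc̄μ', a c̄ μ', −a c ā c̄, c ā μ', q a c ā c̄)` over `(δ₀, ab, ac, bc, abc)`. [folklore] -/
def kappaB (q a c : ℝ) : V5 :=
  ⟨(1 - a) * (1 - c) * lamPOf q a c, a * (1 - c) * lamPOf q a c, -(a * c * (1 - a) * (1 - c)),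
    c * (1 - a) * lamPOf q a c, q * (a * c * (1 - a) * (1 - c))⟩

/-- **Peeling identity (apex `a`)**: `κ * L(0,b,c) = (λλ') · L(1,b,c)`. [folklore] -/
theorem conv_kappaA_leaf (q b c : ℝ) :
    conv (kappaA q b c) (leaf q 0 b c) = scaleV (lamOf q b c * lamPOf q b c) (leaf q 1 b c) := by
  ext <;> simp only [conv, kappaA, leaf, scaleV, lamOf, lamPOf, V5.total] <;> ring

/-- **Peeling identity (apex `b`)**: `κ' * L(a,0,c) = (μμ') · L(a,1,c)`. [folklore] -/
theorem conv_kappaB_leaf (q a c : ℝ) :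
    conv (kappaB q a c) (leaf q a 0 c) = scaleV (lamOf q a c * lamPOf q a c) (leaf q a 1 c) := by
  ext <;> simp only [conv, kappaB, leaf, scaleV, lamOf, lamPOf, V5.total] <;> ring

/-- **The master identity of type T3.**  With `R₂ = L(0,b₁,c₁) * (L(a₂,0,c₂) * R)` (the rest dressed by the two DELETED leaves):
`λλ'μμ' · t3Form(R) = q²(1−q) · envForm q (b₁c̄₁λ') (c₁b̄₁λ') (b₁c₁b̄₁c̄₁) (a₂c̄₂μ') (c₂ā₂μ') (a₂c₂ā₂c̄₂) R₂`. [folklore] -/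
theorem t3_master_identity (q b₁ c₁ a₂ c₂ : ℝ) (R : V5) :
    (lamOf q b₁ c₁ * lamPOf q b₁ c₁) * (lamOf q a₂ c₂ * lamPOf q a₂ c₂) * t3Form q b₁ c₁ a₂ c₂ R =
      q ^ 2 * (1 - q) *
        envForm q (b₁ * (1 - c₁) * lamPOf q b₁ c₁) (c₁ * (1 - b₁) * lamPOf q b₁ c₁) (b₁ * c₁ * (1 - b₁) * (1 - c₁))
          (a₂ * (1 - c₂) * lamPOf q a₂ c₂) (c₂ * (1 - a₂) * lamPOf q a₂ c₂) (a₂ * c₂ * (1 - a₂) * (1 - c₂))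
          (conv (leaf q 0 b₁ c₁) (conv (leaf q a₂ 0 c₂) R)) := by
  set L := lamOf q b₁ c₁ * lamPOf q b₁ c₁ with hL
  set M := lamOf q a₂ c₂ * lamPOf q a₂ c₂ with hM
  set R₂ := conv (leaf q 0 b₁ c₁) (conv (leaf q a₂ 0 c₂) R) with hR₂
  -- the four pinned valuations, peeled
  have e10 : L * val q (conv (leaf q 1 b₁ c₁) (conv (leaf q a₂ 0 c₂) R)) = val q (conv (kappaA q b₁ c₁) R₂) := by
    rw [← val_scaleV, ← conv_scaleV_left, ← conv_kappaA_leaf, conv_assoc']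
  have e01 : M * val q (conv (leaf q 0 b₁ c₁) (conv (leaf q a₂ 1 c₂) R)) = val q (conv (kappaB q a₂ c₂) R₂) := by
    rw [← val_scaleV, ← conv_scaleV_right, ← conv_scaleV_left, ← conv_kappaB_leaf, conv_assoc', conv_comm (leaf q 0 b₁ c₁)]
  have e11 : L * M * val q (conv (leaf q 1 b₁ c₁) (conv (leaf q a₂ 1 c₂) R)) =
      val q (conv (kappaA q b₁ c₁) (conv (kappaB q a₂ c₂) R₂)) := by
    rw [mul_assoc, ← val_scaleV, ← conv_scaleV_right, ← conv_scaleV_left, ← conv_kappaB_leaf, conv_assoc', ← val_scaleV,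
      ← conv_scaleV_left, ← conv_kappaA_leaf, conv_assoc', conv_comm (leaf q 0 b₁ c₁)]
  rw [← rayleigh_T3_eq]
  have key := val_conv_bilin q (kappaA q b₁ c₁) (kappaB q a₂ c₂) R₂
  have expand : L * M * (val q (conv (leaf q 1 b₁ c₁) (conv (leaf q a₂ 0 c₂) R)) * val q (conv (leaf q 0 b₁ c₁) (conv (leaf q a₂ 1 c₂) R)) -
      val q (conv (leaf q 1 b₁ c₁) (conv (leaf q a₂ 1 c₂) R)) * val q (conv (leaf q 0 b₁ c₁) (conv (leaf q a₂ 0 c₂) R))) =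
      (L * val q (conv (leaf q 1 b₁ c₁) (conv (leaf q a₂ 0 c₂) R))) * (M * val q (conv (leaf q 0 b₁ c₁) (conv (leaf q a₂ 1 c₂) R))) -
      (L * M * val q (conv (leaf q 1 b₁ c₁) (conv (leaf q a₂ 1 c₂) R))) * val q R₂ := by
    rw [hR₂]; ring
  rw [expand, e10, e01, e11, key]
  simp only [envForm, kappaA, kappaB]
  ring


/-! ### Admissible coefficient triples -/

/-- An ADMISSIBLE coefficient triple `(A₁, A₂, m)` of a pinned object: `0 ≤ m ≤ A₁, A₂` and `(A₁ − m)(A₂ − m) ≥ m²`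
(every pinned leaf gives one; the frontier is `(A₁−m)(A₂−m) = m²`). [folklore] -/
structure Adm (A₁ A₂ m : ℝ) : Prop where
  /-- `0 ≤ m` -/
  hm : 0 ≤ m
  /-- `m ≤ A₁` -/
  h1 : m ≤ A₁
  /-- `m ≤ A₂` -/
  h2 : m ≤ A₂
  /-- `m² ≤ (A₁ − m)(A₂ − m)` -/
  hprod : m ^ 2 ≤ (A₁ - m) * (A₂ - m)

/-- A frontier triple `(θ(1+θ), 1+θ, θ)`, `θ ≥ 0`, is admissible. [folklore] -/
theorem adm_frontier {θ : ℝ} (hθ : 0 ≤ θ) : Adm (θ * (1 + θ)) (1 + θ) θ :=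
  ⟨hθ, by nlinarith, by linarith, by nlinarith⟩

/-- `λ(b,c) > 0` unless `b = c = 1` (for `q > 0`, `b, c ∈ [0,1]`). [folklore] -/
theorem lamOf_pos {q b c : ℝ} (hq0 : 0 < q) (hb0 : 0 ≤ b) (hb1 : b ≤ 1) (hc0 : 0 ≤ c) (hc1 : c ≤ 1) (h : ¬(b = 1 ∧ c = 1)) :
    0 < lamOf q b c := by
  simp only [lamOf]
  by_cases hb : b = 1
  · have hc : c < 1 := lt_of_le_of_ne hc1 (fun hc => h ⟨hb, hc⟩)
    subst hb; nlinarith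
  · have hb' : b < 1 := lt_of_le_of_ne hb1 hb
    have : 0 < (1 - b) := by linarith
    have : 0 ≤ q * (1 - b) * (1 - c) := by positivity
    have : 0 ≤ b * (1 - c) := by nlinarith
    have : 0 ≤ (1 - b) * c := by nlinarith
    rcases eq_or_lt_of_le hc1 with hc | hc
    · subst hc; nlinarith
    · have : 0 < q * (1 - b) * (1 - c) := by
        have : 0 < 1 - c := by linarith
        positivity
      linarith

/-- `λ'(b,c) = 1 − (1−q)(1−b)(1−c) > 0` for `q > 0`. [folklore] -/
theorem lamPOf_pos {q b c : ℝ} (hq0 : 0 < q) (hq1 : q ≤ 1) (hb0 : 0 ≤ b) (hb1 : b ≤ 1) (hc0 : 0 ≤ c) (hc1 : c ≤ 1) :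
    0 < lamPOf q b c := by
  have e : lamPOf q b c = 1 - (1 - q) * ((1 - b) * (1 - c)) := by simp only [lamPOf, lamOf]; ring
  rw [e]
  have : (1 - b) * (1 - c) ≤ 1 := by nlinarith
  have : 0 ≤ (1 - b) * (1 - c) := by nlinarith
  nlinarith

/-- The coefficient triple of a pinned leaf, `(b c̄ λ', c b̄ λ', b c b̄ c̄)`, is admissible:
`A₁ − m = b c̄ (q b̄ c̄ + b)`, `A₂ − m = c b̄ (q b̄ c̄ + c)`, and `(q b̄c̄ + b)(q b̄c̄ + c) ≥ bc ≥ bc·b̄c̄`. [folklore] -/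
theorem adm_leaf {q b c : ℝ} (hq0 : 0 ≤ q) (hb0 : 0 ≤ b) (hb1 : b ≤ 1) (hc0 : 0 ≤ c) (hc1 : c ≤ 1) :
    Adm (b * (1 - c) * lamPOf q b c) (c * (1 - b) * lamPOf q b c) (b * c * (1 - b) * (1 - c)) := by
  have hb' : 0 ≤ 1 - b := by linarith
  have hc' : 0 ≤ 1 - c := by linarith
  have e1 : b * (1 - c) * lamPOf q b c - b * c * (1 - b) * (1 - c) = b * (1 - c) * (q * (1 - b) * (1 - c) + b) := by
    simp only [lamPOf, lamOf]; ring
  have e2 : c * (1 - b) * lamPOf q b c - b * c * (1 - b) * (1 - c) = c * (1 - b) * (q * (1 - b) * (1 - c) + c) := by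
    simp only [lamPOf, lamOf]; ring
  refine ⟨by positivity, ?_, ?_, ?_⟩
  · have : 0 ≤ b * (1 - c) * (q * (1 - b) * (1 - c) + b) := by positivity
    linarith
  · have : 0 ≤ c * (1 - b) * (q * (1 - b) * (1 - c) + c) := by positivity
    linarith
  · rw [e1, e2]
    have hB : b * c ≤ (q * (1 - b) * (1 - c) + b) * (q * (1 - b) * (1 - c) + c) := by
      have : 0 ≤ q * (1 - b) * (1 - c) := by positivity
      nlinarith
    have hD : (1 - b) * (1 - c) ≤ 1 := by nlinarith
    have hbc : 0 ≤ b * c * (1 - b) * (1 - c) := by positivity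
    calc (b * c * (1 - b) * (1 - c)) ^ 2
        = (b * c * (1 - b) * (1 - c)) * ((1 - b) * (1 - c)) * (b * c) := by ring
      _ ≤ (b * c * (1 - b) * (1 - c)) * 1 * ((q * (1 - b) * (1 - c) + b) * (q * (1 - b) * (1 - c) + c)) := by
          apply mul_le_mul (mul_le_mul_of_nonneg_left hD hbc) hB (by positivity) (by positivity)
      _ = b * (1 - c) * (q * (1 - b) * (1 - c) + b) * (c * (1 - b) * (q * (1 - b) * (1 - c) + c)) := by ring


end ThreeApex

end FK

end Summit.CriticalPhenomena.PercolationContinuityZ3.Theorems
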